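import Literature.NumberTheory.GaloisRepresentations.LubinTateColemanUnitsImageModuleTwo
import HarnessLib

/-!
# `N ≅ 𝒰¹_∞`: the two-variable Coleman transform as a MAP into the module `M = (ColemanCoordModule)^{ℤ/d}` — additive, with image
# exactly the submodule `unitsImage`, injective on principal families; the bijection `{principal coherent β} ≃ unitsImage`

De Shalit, *Iwasawa theory of elliptic curves with complex multiplication* (1987), Ch. I §3.7 Theorem, §3.8 (17); Ch. III §1.3.  Sequel of
`LubinTateColemanUnitsImageModuleTwo` (the submodule `N = unitsImage` over `Λ = 𝒪_F⟦X⟧⟦T⟧`).  The transform of the tree is an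
`∃!`-statement (`existsUnique_colemanTransformProd₂`); THIS file names it as a function and proves the group-theoretic half of
"`i : 𝒰 ⊗̂ 𝒪 ≅ i(𝒰)`" at `q = 2`:

* `colemanImage β hβ : ℤ/d → ColemanCoordModule …` — THE transform of a baseNorm-coherent family `β = (β_m ∈ 𝒰(E_m K_π^∞))_m` as an element
  of `M`; `isTransformProd_colemanImage` (its defining congruences), `toPS_colemanImage_eq_of_isTransformProd` (uniqueness);
* ★ `colemanImage_mul` / `colemanImage_one` — **additivity** `Col(ββ') = Col β + Col β'` (`relUnitCoordTwo_mul` + linearity of the congruences);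
* ★ `colemanImage_mem_unitsImage` — `Col β ∈ N`; ★ `exists_colemanImage_eq_of_mem_unitsImage` — every element of `N` is `Col β` for a PRINCIPAL
  coherent `β`; ★ `colemanImage_injective` — injective on principal families (`eq_of_colemanTransformProd₂_eq`);
* ★★ **`colemanImageEquiv : principalCoherentFamilies … ≃ unitsImage …`** with `colemanImageEquiv_mul` — the bijection `𝒰¹_∞ ≅ N`
  carrying products to sums: de Shalit's `i` restricted to the principal norm-coherent units of the two-variable tower IS an isomorphism
  onto the `Λ`-submodule `N` (so `𝒰¹_∞` acquires its `Λ`-module structure by transport, and `M/N` — pseudo-null — is the cokernel of `i`).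

Everything PROVED (0 sorry, no named facts); definitions `colemanImage`, `principalCoherentFamilies`, `colemanImageEquiv`.

## References
* E. de Shalit, *Iwasawa theory of elliptic curves with complex multiplication* (1987), Ch. I §3.4 Lemma (i), §3.7 Theorem, §3.8 (17);
  Ch. III §1.3. [deShalit1987]
-/

noncomputable section

namespace Literature.NumberTheory.GaloisRepresentations
section UnitsImageEquivTwo

open GaloisRepresentations.IsNonarchimedeanLocalField LubinTate ValuativeRel Field Finset

variable {F : Type} [Field F] [ValuativeRel F] [TopologicalSpace F] [IsNonarchimedeanLocalField F]

attribute [local instance] ltNormUniformSpace ltNormIsUniformAddGroup rk1 nF nE fintypeResidueField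

variable {p : ℕ} [hp : Fact p.Prime] {d : ℕ} (hd : d.Coprime p)
variable {π : 𝒪[F]} (hπ : (valuation F).IsUniformizer (π : F))
variable (E : ℕ → IntermediateField F (AlgebraicClosure F)) [∀ m, FiniteDimensional F (E m)] [∀ m, Normal F (E m)]
  [∀ m, IsGalois F (E m)] (hmono : Monotone E) (hE : ∀ m, E m ≤ maxUnramified F) (hdeg : ∀ m, Module.finrank F (E m) = d * p ^ m)
  {σ₀ : absoluteGaloisGroup F} (hσ₀ : IsAbsArithFrob σ₀) (hq : residueFieldCard F = 2)
variable (u : (LTCoeff F)ˣ) (hu : LTCoeff.of F π = residueFieldCard F * u) (γ : 𝒪[F]ˣ)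
variable [NeZero d] [IsAdicComplete (Ideal.span {(p : 𝒪[F])}) 𝒪[F]]
variable {θ : ∀ m, unitBall (E m)} (hθ : ∀ m, IsIntegralNormalGen (E m) (θ m))
  (hcoh : ∀ m, unitBallTrace (hmono (Nat.le_succ m)) (θ (m + 1)) = θ m)

/-! ### The transform as a function into `M` -/

include hdeg in
/-- **`colemanImage β hβ`**: the two-variable Coleman transform of the baseNorm-coherent family `β` as an element of
`M = (ColemanCoordModule)^{ℤ/d}` (the witness of `existsUnique_colemanTransformProd₂`). [cite: deShalit1987, Ch. I §3.7, §3.8 (17)] -/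
def colemanImage {β : ∀ m, RelNormCoherentUnits hπ (E m)} (hβ : ∀ m, (β (m + 1)).baseNorm hπ (hmono (Nat.le_succ m)) = β m) :
    ZMod d → ColemanCoordModule hπ hq (intBase F) u hu γ :=
  fun j => TActModule.ofPS _ _ ((existsUnique_colemanTransformProd₂ p d hd hπ E hmono hE hdeg hσ₀ hq hθ hcoh u hu hβ).choose j)

include hdeg in
/-- The defining congruences of `colemanImage β`. [cite: deShalit1987, Ch. I §3.8 (17)] -/
theorem isTransformProd_colemanImage {β : ∀ m, RelNormCoherentUnits hπ (E m)}
    (hβ : ∀ m, (β (m + 1)).baseNorm hπ (hmono (Nat.le_succ m)) = β m) :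
    IsTransformProd p d hd σ₀ hθ (fun m => relUnitCoordTwo hπ (E m) hq (hE m) hσ₀ u hu (β m))
      (fun j => TActModule.toPS (colemanImage hd hπ E hmono hE hdeg hσ₀ hq u hu γ hθ hcoh hβ j)) :=
  fun m k j => (existsUnique_colemanTransformProd₂ p d hd hπ E hmono hE hdeg hσ₀ hq hθ hcoh u hu hβ).choose_spec.1 m k j

include hdeg in
/-- **Uniqueness**: any `G'` satisfying the congruences of `β` is `colemanImage β`. [cite: deShalit1987, Ch. I §3.8 (17)] -/
theorem toPS_colemanImage_eq_of_isTransformProd {β : ∀ m, RelNormCoherentUnits hπ (E m)}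
    (hβ : ∀ m, (β (m + 1)).baseNorm hπ (hmono (Nat.le_succ m)) = β m) {G' : ZMod d → PowerSeries (PowerSeries 𝒪[F])}
    (hG' : IsTransformProd p d hd σ₀ hθ (fun m => relUnitCoordTwo hπ (E m) hq (hE m) hσ₀ u hu (β m)) G') :
    (fun j => TActModule.toPS (colemanImage hd hπ E hmono hE hdeg hσ₀ hq u hu γ hθ hcoh hβ j)) = G' := by
  have huniq := (existsUnique_colemanTransformProd₂ p d hd hπ E hmono hE hdeg hσ₀ hq hθ hcoh u hu hβ).unique
    (isTransformProd_colemanImage hd hπ E hmono hE hdeg hσ₀ hq u hu γ hθ hcoh hβ) (fun m k j => hG' m k j)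
  exact huniq

/-! ### Additivity -/

variable {hd E hθ} in
omit [NeZero d] [IsAdicComplete (Ideal.span {(p : 𝒪[F])}) 𝒪[F]] in
/-- The congruences add: transforms of `r, r'` give a transform of `r + r'`. [cite: deShalit1987, Ch. I §3.8 (17)] -/
theorem IsTransformProd.add {r r' : ∀ m, PowerSeries (unitBall (E m))} {G G' : ZMod d → PowerSeries (PowerSeries 𝒪[F])}
    (h : IsTransformProd p d hd σ₀ hθ r G) (h' : IsTransformProd p d hd σ₀ hθ r' G') : IsTransformProd p d hd σ₀ hθ (r + r') (G + G') := by
  intro m k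
  have e1 : (fun j => PowerSeries.coeff k ((G + G') j)) = (fun j => PowerSeries.coeff k (G j)) + fun j => PowerSeries.coeff k (G' j) :=
    funext fun j => by rw [Pi.add_apply, map_add, Pi.add_apply]
  rw [e1, Pi.add_apply, map_add]
  exact (h m k).add (h' m k)

variable {E} in
omit [NeZero d] [IsAdicComplete (Ideal.span {(p : 𝒪[F])}) 𝒪[F]] in
/-- `(0, 0)` satisfies the congruences. [cite: deShalit1987, Ch. I §3.8 (17)] -/
theorem IsTransformProd.zero : IsTransformProd p d hd σ₀ hθ (fun _ => 0) (fun _ => 0) := by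
  intro m k
  simp only [map_zero]
  exact IsAmiceLevel.zero

include hdeg in
/-- ★ **`Col(β·β') = Col β + Col β'`** (`r_{ββ'} = r_β + r_{β'}` levelwise, `relUnitCoordTwo_mul`). [cite: deShalit1987, Ch. I §3.4 Lemma (i), §3.7] -/
theorem colemanImage_mul {β β' : ∀ m, RelNormCoherentUnits hπ (E m)}
    (hβ : ∀ m, (β (m + 1)).baseNorm hπ (hmono (Nat.le_succ m)) = β m) (hβ' : ∀ m, (β' (m + 1)).baseNorm hπ (hmono (Nat.le_succ m)) = β' m)
    (hββ' : ∀ m, ((β (m + 1)).mul (β' (m + 1))).baseNorm hπ (hmono (Nat.le_succ m)) = (β m).mul (β' m)) :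
    colemanImage hd hπ E hmono hE hdeg hσ₀ hq u hu γ hθ hcoh (β := fun m => (β m).mul (β' m)) hββ' =
      colemanImage hd hπ E hmono hE hdeg hσ₀ hq u hu γ hθ hcoh hβ + colemanImage hd hπ E hmono hE hdeg hσ₀ hq u hu γ hθ hcoh hβ' := by
  have hsum : IsTransformProd p d hd σ₀ hθ (fun m => relUnitCoordTwo hπ (E m) hq (hE m) hσ₀ u hu ((β m).mul (β' m)))
      ((fun j => TActModule.toPS (colemanImage hd hπ E hmono hE hdeg hσ₀ hq u hu γ hθ hcoh hβ j)) +
        fun j => TActModule.toPS (colemanImage hd hπ E hmono hE hdeg hσ₀ hq u hu γ hθ hcoh hβ' j)) := by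
    have e : (fun m => relUnitCoordTwo hπ (E m) hq (hE m) hσ₀ u hu ((β m).mul (β' m))) =
        (fun m => relUnitCoordTwo hπ (E m) hq (hE m) hσ₀ u hu (β m)) + fun m => relUnitCoordTwo hπ (E m) hq (hE m) hσ₀ u hu (β' m) :=
      funext fun m => by rw [Pi.add_apply, relUnitCoordTwo_mul]
    rw [e]
    exact (isTransformProd_colemanImage hd hπ E hmono hE hdeg hσ₀ hq u hu γ hθ hcoh hβ).add
      (isTransformProd_colemanImage hd hπ E hmono hE hdeg hσ₀ hq u hu γ hθ hcoh hβ')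
  have h := toPS_colemanImage_eq_of_isTransformProd hd hπ E hmono hE hdeg hσ₀ hq u hu γ hθ hcoh (β := fun m => (β m).mul (β' m)) hββ' hsum
  funext j
  exact TActModule.toPS_injective (congrFun h j)

omit [∀ m, Normal F (E m)] in
/-- Products of baseNorm-coherent families are baseNorm-coherent. [cite: deShalit1987, Ch. I §3.8 (16)] -/
theorem baseNormCoherent_mul {β β' : ∀ m, RelNormCoherentUnits hπ (E m)}
    (hβ : ∀ m, (β (m + 1)).baseNorm hπ (hmono (Nat.le_succ m)) = β m) (hβ' : ∀ m, (β' (m + 1)).baseNorm hπ (hmono (Nat.le_succ m)) = β' m)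
    (m : ℕ) : ((β (m + 1)).mul (β' (m + 1))).baseNorm hπ (hmono (Nat.le_succ m)) = (β m).mul (β' m) := by
  rw [RelNormCoherentUnits.baseNorm_mul, hβ, hβ']

omit [∀ m, Normal F (E m)] in
/-- The trivial family is baseNorm-coherent. [cite: deShalit1987, Ch. I §3.8 (16)] -/
theorem baseNormCoherent_one (m : ℕ) :
    (RelNormCoherentUnits.one : RelNormCoherentUnits hπ (E (m + 1))).baseNorm hπ (hmono (Nat.le_succ m)) = RelNormCoherentUnits.one :=
  RelNormCoherentUnits.baseNorm_one hπ _

include hdeg in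
/-- `Col(1) = 0`. [cite: deShalit1987, Ch. I §3.4 Lemma (i)] -/
theorem colemanImage_one :
    colemanImage hd hπ E hmono hE hdeg hσ₀ hq u hu γ hθ hcoh (β := fun m => (RelNormCoherentUnits.one : RelNormCoherentUnits hπ (E m)))
      (baseNormCoherent_one hπ E hmono) = 0 := by
  have h0 : IsTransformProd p d hd σ₀ hθ (fun m => relUnitCoordTwo hπ (E m) hq (hE m) hσ₀ u hu
      (RelNormCoherentUnits.one : RelNormCoherentUnits hπ (E m))) (fun _ => 0) := by
    have e : (fun m => relUnitCoordTwo hπ (E m) hq (hE m) hσ₀ u hu (RelNormCoherentUnits.one : RelNormCoherentUnits hπ (E m))) = fun _ => 0 :=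
      funext fun m => relUnitCoordTwo_one hπ (E m) hq (hE m) hσ₀ u hu
    rw [e]; exact IsTransformProd.zero hd hθ
  have h := toPS_colemanImage_eq_of_isTransformProd hd hπ E hmono hE hdeg hσ₀ hq u hu γ hθ hcoh (baseNormCoherent_one hπ E hmono) h0
  funext j
  exact TActModule.toPS_injective (congrFun h j)

/-! ### The principal coherent families `𝒰¹_∞` -/

/-- **`principalCoherentFamilies`**: the baseNorm-coherent families `β = (β_m ∈ 𝒰(E_m·K_π^∞))_m` of PRINCIPAL units — Rubin's / de Shalit's
`𝒰¹_∞ = lim← U¹` along the two-variable local tower, as a set of families. [cite: deShalit1987, Ch. I §3.8 (16)–(17); Ch. III §1.3] -/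
def principalCoherentFamilies : Set (∀ m, RelNormCoherentUnits hπ (E m)) :=
  {β | (∀ m, (β (m + 1)).baseNorm hπ (hmono (Nat.le_succ m)) = β m) ∧
    ∀ m, ‖(((β m).val 0 : unitBall (E m ⊔ ltField π 0 : IntermediateField F (AlgebraicClosure F))) :
      (E m ⊔ ltField π 0 : IntermediateField F (AlgebraicClosure F))) - 1‖ < 1}

omit [∀ m, Normal F (E m)] in
/-- Membership in `principalCoherentFamilies` (unfolding). [cite: deShalit1987, Ch. I §3.8 (16)–(17)] -/
theorem mem_principalCoherentFamilies_iff (β : ∀ m, RelNormCoherentUnits hπ (E m)) :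
    β ∈ principalCoherentFamilies hπ E hmono ↔ (∀ m, (β (m + 1)).baseNorm hπ (hmono (Nat.le_succ m)) = β m) ∧
      ∀ m, ‖(((β m).val 0 : unitBall (E m ⊔ ltField π 0 : IntermediateField F (AlgebraicClosure F))) :
        (E m ⊔ ltField π 0 : IntermediateField F (AlgebraicClosure F))) - 1‖ < 1 := Iff.rfl

/-! ### Image `= unitsImage`, injectivity on principal families -/

variable [IsAdicComplete (Ideal.span {intBase F (LTCoeff.of F π)}) (PowerSeries 𝒪[F])]
  [CharZero F] (hI : Ideal.span {(p : 𝒪[F])} ≠ ⊤) (hud : ∀ m, (u : LTCoeff F) ^ Module.finrank F (E m) ≠ 1)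
  (hm : ∃ m₁ : ℕ, LTCoeff.of F π ^ 2 ∣ LTCoeff.of F π - m₁)

include hdeg hm in
/-- ★ **`Col β ∈ N`** for every baseNorm-coherent family `β`. [cite: deShalit1987, Ch. I §3.7, §3.8 (17)] -/
theorem colemanImage_mem_unitsImage {β : ∀ m, RelNormCoherentUnits hπ (E m)}
    (hβ : ∀ m, (β (m + 1)).baseNorm hπ (hmono (Nat.le_succ m)) = β m)
    (hβ1 : ∀ m, ‖(((β m).val 0 : unitBall (E m ⊔ ltField π 0 : IntermediateField F (AlgebraicClosure F))) :
      (E m ⊔ ltField π 0 : IntermediateField F (AlgebraicClosure F))) - 1‖ < 1) :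
    colemanImage hd hπ E hmono hE hdeg hσ₀ hq u hu γ hθ hcoh hβ ∈ unitsImage hd hπ E hmono hE hdeg hσ₀ hq u hu γ hθ hcoh hI hud :=
  (mem_unitsImage_iff_exists_principal hπ E hmono hE hdeg hσ₀ hq u hu γ hθ hcoh hI hud hm _).mpr
    ⟨β, hβ, hβ1, isTransformProd_colemanImage hd hπ E hmono hE hdeg hσ₀ hq u hu γ hθ hcoh hβ⟩

include hdeg hm in
/-- ★ **Every element of `N` is `Col β` for a PRINCIPAL baseNorm-coherent `β`.** [cite: deShalit1987, Ch. I §3.7, §3.8 (17)] -/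
theorem exists_colemanImage_eq_of_mem_unitsImage {G : ZMod d → ColemanCoordModule hπ hq (intBase F) u hu γ}
    (hG : G ∈ unitsImage hd hπ E hmono hE hdeg hσ₀ hq u hu γ hθ hcoh hI hud) :
    ∃ (β : ∀ m, RelNormCoherentUnits hπ (E m)) (hβ : ∀ m, (β (m + 1)).baseNorm hπ (hmono (Nat.le_succ m)) = β m),
      (∀ m, ‖(((β m).val 0 : unitBall (E m ⊔ ltField π 0 : IntermediateField F (AlgebraicClosure F))) :
        (E m ⊔ ltField π 0 : IntermediateField F (AlgebraicClosure F))) - 1‖ < 1) ∧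
      colemanImage hd hπ E hmono hE hdeg hσ₀ hq u hu γ hθ hcoh hβ = G := by
  obtain ⟨β, hβ, hβ1, hβG⟩ := (mem_unitsImage_iff_exists_principal hπ E hmono hE hdeg hσ₀ hq u hu γ hθ hcoh hI hud hm G).mp hG
  refine ⟨β, hβ, hβ1, funext fun j => TActModule.toPS_injective (congrFun
    (toPS_colemanImage_eq_of_isTransformProd hd hπ E hmono hE hdeg hσ₀ hq u hu γ hθ hcoh hβ hβG) j)⟩

omit [IsAdicComplete (Ideal.span {intBase F (LTCoeff.of F π)}) (PowerSeries 𝒪[F])] in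
include hdeg hI hud in
/-- ★ **`Col` is injective on principal families** (`eq_of_colemanTransformProd₂_eq`). [cite: deShalit1987, Ch. I §3.7, §3.8 (17)] -/
theorem colemanImage_injective {β β' : ∀ m, RelNormCoherentUnits hπ (E m)}
    (hβ : ∀ m, (β (m + 1)).baseNorm hπ (hmono (Nat.le_succ m)) = β m) (hβ' : ∀ m, (β' (m + 1)).baseNorm hπ (hmono (Nat.le_succ m)) = β' m)
    (hβ1 : ∀ m, ‖(((β m).val 0 : unitBall (E m ⊔ ltField π 0 : IntermediateField F (AlgebraicClosure F))) :
      (E m ⊔ ltField π 0 : IntermediateField F (AlgebraicClosure F))) - 1‖ < 1)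
    (hβ'1 : ∀ m, ‖(((β' m).val 0 : unitBall (E m ⊔ ltField π 0 : IntermediateField F (AlgebraicClosure F))) :
      (E m ⊔ ltField π 0 : IntermediateField F (AlgebraicClosure F))) - 1‖ < 1)
    (h : colemanImage hd hπ E hmono hE hdeg hσ₀ hq u hu γ hθ hcoh hβ = colemanImage hd hπ E hmono hE hdeg hσ₀ hq u hu γ hθ hcoh hβ') :
    β = β' := by
  refine eq_of_colemanTransformProd₂_eq p d hd hπ E hE hdeg hσ₀ hq hI hθ u hu hud hβ1 hβ'1
    (fun j => TActModule.toPS (colemanImage hd hπ E hmono hE hdeg hσ₀ hq u hu γ hθ hcoh hβ j))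
    (isTransformProd_colemanImage hd hπ E hmono hE hdeg hσ₀ hq u hu γ hθ hcoh hβ) ?_
  rw [h]
  exact isTransformProd_colemanImage hd hπ E hmono hE hdeg hσ₀ hq u hu γ hθ hcoh hβ'

/-! ### The bijection `𝒰¹_∞ ≃ N` -/

include hdeg hm in
/-- ★★ **`𝒰¹_∞ ≃ N`: the Coleman transform is a BIJECTION from the principal coherent families onto the submodule `unitsImage`.**
[cite: deShalit1987, Ch. I §3.7 Theorem, §3.8 (17); Ch. III §1.3] -/
def colemanImageEquiv :
    principalCoherentFamilies hπ E hmono ≃ unitsImage hd hπ E hmono hE hdeg hσ₀ hq u hu γ hθ hcoh hI hud where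
  toFun β := ⟨colemanImage hd hπ E hmono hE hdeg hσ₀ hq u hu γ hθ hcoh β.2.1,
    colemanImage_mem_unitsImage hd hπ E hmono hE hdeg hσ₀ hq u hu γ hθ hcoh hI hud hm β.2.1 β.2.2⟩
  invFun G := ⟨(exists_colemanImage_eq_of_mem_unitsImage hd hπ E hmono hE hdeg hσ₀ hq u hu γ hθ hcoh hI hud hm G.2).choose,
    (exists_colemanImage_eq_of_mem_unitsImage hd hπ E hmono hE hdeg hσ₀ hq u hu γ hθ hcoh hI hud hm G.2).choose_spec.fst,
    (exists_colemanImage_eq_of_mem_unitsImage hd hπ E hmono hE hdeg hσ₀ hq u hu γ hθ hcoh hI hud hm G.2).choose_spec.snd.1⟩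
  left_inv β := by
    have hs := (exists_colemanImage_eq_of_mem_unitsImage hd hπ E hmono hE hdeg hσ₀ hq u hu γ hθ hcoh hI hud hm
      (colemanImage_mem_unitsImage hd hπ E hmono hE hdeg hσ₀ hq u hu γ hθ hcoh hI hud hm β.2.1 β.2.2)).choose_spec
    exact Subtype.ext (colemanImage_injective hd hπ E hmono hE hdeg hσ₀ hq u hu γ hθ hcoh hI hud hs.fst β.2.1 hs.snd.1 β.2.2 hs.snd.2)
  right_inv G := Subtype.ext
    (exists_colemanImage_eq_of_mem_unitsImage hd hπ E hmono hE hdeg hσ₀ hq u hu γ hθ hcoh hI hud hm G.2).choose_spec.snd.2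

include hdeg hm in
/-- Unfolding `colemanImageEquiv`. [cite: deShalit1987, Ch. I §3.8 (17)] -/
theorem coe_colemanImageEquiv_apply (β : principalCoherentFamilies hπ E hmono) :
    ((colemanImageEquiv hd hπ E hmono hE hdeg hσ₀ hq u hu γ hθ hcoh hI hud hm β : unitsImage hd hπ E hmono hE hdeg hσ₀ hq u hu γ hθ hcoh hI hud) :
        ZMod d → ColemanCoordModule hπ hq (intBase F) u hu γ) =
      colemanImage hd hπ E hmono hE hdeg hσ₀ hq u hu γ hθ hcoh β.2.1 := rfl

include hdeg hm in
/-- ★ **`𝒰¹_∞ ≃ N` carries products to sums** (the transported structure is the `Λ`-module structure of de Shalit's `𝒰 ⊗̂ 𝒪`).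
[cite: deShalit1987, Ch. I §3.4 Lemma (i), §3.7] -/
theorem colemanImageEquiv_mul (β β' : principalCoherentFamilies hπ E hmono)
    (hββ' : (fun m => (β.1 m).mul (β'.1 m)) ∈ principalCoherentFamilies hπ E hmono) :
    ((colemanImageEquiv hd hπ E hmono hE hdeg hσ₀ hq u hu γ hθ hcoh hI hud hm ⟨_, hββ'⟩ :
        unitsImage hd hπ E hmono hE hdeg hσ₀ hq u hu γ hθ hcoh hI hud) : ZMod d → ColemanCoordModule hπ hq (intBase F) u hu γ) =
      (colemanImageEquiv hd hπ E hmono hE hdeg hσ₀ hq u hu γ hθ hcoh hI hud hm β : ZMod d → ColemanCoordModule hπ hq (intBase F) u hu γ) +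
        (colemanImageEquiv hd hπ E hmono hE hdeg hσ₀ hq u hu γ hθ hcoh hI hud hm β' : ZMod d → ColemanCoordModule hπ hq (intBase F) u hu γ) := by
  rw [coe_colemanImageEquiv_apply, coe_colemanImageEquiv_apply, coe_colemanImageEquiv_apply]
  exact colemanImage_mul hd hπ E hmono hE hdeg hσ₀ hq u hu γ hθ hcoh β.2.1 β'.2.1 _

end UnitsImageEquivTwo

end Literature.NumberTheory.GaloisRepresentations
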